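import Mathlib
import HarnessLib
import Summits.RiemannHypothesis.RiemannHypothesis.Theorems.IntegerScrewN6OneEstimates

/-!
# Route `IntegerScrew` — ★ THEOREM N6₁ (PIVOT-LAW 13.45): CONJECTURE N6 AT ITS LEADING ORDER,
# `log M / f_M(log M + s) = log log M + O(log log log M)` for every fixed `s ≥ 0` — RH-free, in the kernel

`f_M(a) = windowFloor M a` is the per-window floor of the intercept problem (PIVOT-LAW §13.3;
`IntegerScrewCouplingDefs`).  THEOREM N6₁ says that at the heights `a = log M + s` the floor is
`log M/(log log M + O(log log log M))`.  The proof is PIVOT-LAW 13.45's one line each way, assembled from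
kernel objects only:

* `1/f_M(L+s) = ∫₀^∞ e^{−(L+s)t}(e^{tN_M})₁₁dt` (`IntegerScrewFloorLaplace`, PROP. N2 for `(L+s)I − N_M ≻ 0`);
* the Feynman–Kac sandwich `e^{(L−6)t}p⁰₁₁(tL) ≤ (e^{tN_M})₁₁ ≤ e^{(L+6)t}p⁰₁₁(tL)` (`IntegerScrewCouplingDoob`);
* THEOREM C♯ `e^{−16τ/L}g(τ) ≤ p⁰₁₁(τ) ≤ e^{65τ/L}g(τ)` (`IntegerScrewCSharpUpper.returnProb_csharp`);
* the window integral `log T − 1 ≤ ∫₀^T g ≤ 1 + log T` and `g ≤ 1/τ` (`IntegerScrewWindowIntegral`,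
  `IntegerScrewHarmonicK`);
* the spectral tail `(e^{(t+1)N_M})₁₁ ≤ e^{νt}(e^{N_M})₁₁`, `ν = log M − γ/2` (`IntegerScrewFloorLaplace`).

Results (`L = log M`):

* (`IntegerScrewN6OneEstimates`: the two explicit integral estimates `windowFloor_inv_ge/_le` with a free cut `T`;
  here `T = 1/log L`);
* `log_div_windowFloor_ge` — `L/f_M(L+s) ≥ log L − log log L − (s + 23)` for all large `M`;
* `log_div_windowFloor_le(_uniform)` — `L/f_M(L+s) ≤ log L + e^{71}·log log L + e^{75}` for all large `M`
  (the threshold independent of `s ≥ 0`: 13.45's «uniformity in s»);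
* `n6_one` — **THEOREM N6₁**: `∃ C, ∀ᶠ M, |log M/f_M(log M + s) − log log M| ≤ C·log log log M`;
* `not_conjecture_Nplus` — PROP. N5 (13.11): CONJECTURE N⁺ («f_M(log M + s) ≥ φ·log M») is false;
* `tendsto_log_div_windowFloor_div`, `tendsto_windowFloor_mul_log_log_div` — the ratio forms (→ 1).

RH-free (`N_M` and the walk are arithmetic objects); nothing here bears on the truth of RH.  References:
PIVOT-LAW §13.45, CONTINUUM-LIMIT §17 (rh-explicit A6-PIVOT); M. Suzuki, J. Lond. Math. Soc. (2) 108 (2023)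
1448–1487 [Suzuki2023] for the screw matrices whose intercept energy `f_M` bounds (THEOREM 8).
-/

noncomputable section

-- D-0017: `Summit.<S>.<S>.…` is the designed namespace of a single-problem summit.
set_option linter.dupNamespace false

namespace Summit.RiemannHypothesis.RiemannHypothesis.Theorems.IntegerScrew

open scoped Matrix.Norms.Operator
open NormedSpace Matrix Finset Filter MeasureTheory Set

/-! ### THEOREM N6₁ -/

section Asymptotic

/-- The three logarithmic scales tend to `∞` along `M : ℕ`. -/
theorem tendsto_log_log_natCast : Tendsto (fun M : ℕ => Real.log (Real.log (M : ℝ))) atTop atTop :=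
  Real.tendsto_log_atTop.comp (Real.tendsto_log_atTop.comp tendsto_natCast_atTop_atTop)

/-- `log log log M → ∞` along `M : ℕ`. -/
theorem tendsto_log_log_log_natCast :
    Tendsto (fun M : ℕ => Real.log (Real.log (Real.log (M : ℝ)))) atTop atTop :=
  Real.tendsto_log_atTop.comp tendsto_log_log_natCast

/-- PROP. N2 in the form used here: eventually `cᵀN_Mc ≤ (log M − γ/2)‖c‖²`. -/
theorem couplingMatrix_form_le_half_gamma_eventually :
    ∀ᶠ M : ℕ in atTop, ∀ v : ↥(Finset.Icc 1 M) → ℝ,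
      v ⬝ᵥ (couplingMatrix M *ᵥ v) ≤ (Real.log M - Real.eulerMascheroniConstant / 2) * (v ⬝ᵥ v) := by
  have hγ : 0 < Real.eulerMascheroniConstant := by
    linarith [Real.one_half_lt_eulerMascheroniConstant]
  filter_upwards [couplingMatrix_form_le_eventually (half_pos hγ)] with M hM v
  have h := hM v
  have e : Real.log M - Real.eulerMascheroniConstant + Real.eulerMascheroniConstant / 2 =
      Real.log M - Real.eulerMascheroniConstant / 2 := by ring
  rw [e] at h
  exact h

/-- **THEOREM N6₁, lower half**: for every `s ≥ 0`, for all large `M` (`L = log M`),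
`log L − log log L − (s + 23) ≤ L / f_M(L + s)`. -/
theorem log_div_windowFloor_ge {s : ℝ} (hs : 0 ≤ s) :
    ∀ᶠ M : ℕ in atTop,
      Real.log (Real.log M) - Real.log (Real.log (Real.log M)) - (s + 23) ≤
        Real.log M / windowFloor M (Real.log M + s) := by
  filter_upwards [eventually_ge_atTop 2, couplingMatrix_form_le_half_gamma_eventually,
    tendsto_log_log_natCast.eventually_ge_atTop (1 : ℝ)] with M hM hform hℓ
  set L : ℝ := Real.log M with hLdef
  set ℓ : ℝ := Real.log L with hℓdef
  have hγ0 : 1 / 2 < Real.eulerMascheroniConstant := Real.one_half_lt_eulerMascheroniConstant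
  have hL : 0 < L := Real.log_pos (by exact_mod_cast hM)
  have hℓ0 : 0 < ℓ := by linarith
  have h1 : 1 ∈ Finset.Icc 1 M := Finset.mem_Icc.2 ⟨le_rfl, by omega⟩
  have hν : L - Real.eulerMascheroniConstant / 2 < L + s := by linarith
  -- the cut T = 1/ℓ
  have hT : 0 < 1 / ℓ := by positivity
  have hℓL : ℓ ≤ L := by
    have := Real.log_le_sub_one_of_pos hL; rw [← hℓdef] at this; linarith
  have hLT : 1 ≤ L * (1 / ℓ) := by
    rw [mul_one_div, le_div_iff₀ hℓ0, one_mul]; exact hℓL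
  have hest := windowFloor_inv_ge hM h1 hs hform hν hT hLT
  have hfpos : 0 < windowFloor M (L + s) :=
    windowFloor_pos h1 (windowMatrix_posDef_of_form_le _ (couplingMatrix_isHermitian M) hform hν)
  -- L/f = L · (1/f)
  rw [div_eq_mul_inv]
  have hkey : L * (Real.exp (-((s + 22) * (1 / ℓ))) * (Real.log (L * (1 / ℓ)) - 1) / L) ≤
      L * (windowFloor M (L + s))⁻¹ := mul_le_mul_of_nonneg_left hest hL.le
  refine le_trans ?_ hkey
  have hlog : Real.log (L * (1 / ℓ)) = ℓ - Real.log ℓ := by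
    rw [mul_one_div, Real.log_div hL.ne' hℓ0.ne']
  rw [hlog, mul_div_assoc', mul_comm L, mul_div_assoc, div_self hL.ne', mul_one]
  -- e^{−x} ≥ 1 − x with x = (s+22)/ℓ, and 0 ≤ ℓ − log ℓ − 1 ≤ ℓ
  set x : ℝ := (s + 22) * (1 / ℓ) with hx
  have hx0 : 0 ≤ x := by positivity
  have hA0 : 0 ≤ ℓ - Real.log ℓ - 1 := by linarith [Real.log_le_sub_one_of_pos hℓ0]
  have hAℓ : ℓ - Real.log ℓ - 1 ≤ ℓ := by linarith [Real.log_nonneg hℓ]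
  have hexp : 1 - x ≤ Real.exp (-x) := by linarith [Real.add_one_le_exp (-x)]
  have hxℓ : x * ℓ = s + 22 := by rw [hx]; field_simp
  calc ℓ - Real.log ℓ - (s + 23) = (ℓ - Real.log ℓ - 1) - x * ℓ := by rw [hxℓ]; ring
    _ ≤ (ℓ - Real.log ℓ - 1) - x * (ℓ - Real.log ℓ - 1) := by nlinarith
    _ = (1 - x) * (ℓ - Real.log ℓ - 1) := by ring
    _ ≤ Real.exp (-x) * (ℓ - Real.log ℓ - 1) := mul_le_mul_of_nonneg_right hexp hA0

/-- `e^x ≤ 1 + 2x` for `0 ≤ x ≤ 1`. -/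
theorem exp_le_one_add_two_mul {x : ℝ} (h0 : 0 ≤ x) (h1 : x ≤ 1) : Real.exp x ≤ 1 + 2 * x := by
  have h := Real.abs_exp_sub_one_sub_id_le (x := x) (by rw [abs_of_nonneg h0]; exact h1)
  have h2 := (abs_le.1 h).2
  nlinarith

/-- **THEOREM N6₁, upper half, UNIFORMLY IN `s ≥ 0`** (13.45 «UNIFORMITY IN s»): for all large `M`
(`L = log M`) and every `s ≥ 0`, `L / f_M(L + s) ≤ log L + e^{71}·log log L + e^{75}`. -/
theorem log_div_windowFloor_le_uniform :
    ∀ᶠ M : ℕ in atTop, ∀ s : ℝ, 0 ≤ s →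
      Real.log M / windowFloor M (Real.log M + s) ≤
        Real.log (Real.log M) + Real.exp 71 * Real.log (Real.log (Real.log M)) + Real.exp 75 := by
  filter_upwards [eventually_ge_atTop 2, couplingMatrix_form_le_half_gamma_eventually,
    tendsto_log_log_natCast.eventually_ge_atTop (142 : ℝ)] with M hM hform hℓ s hs
  set L : ℝ := Real.log M with hLdef
  set ℓ : ℝ := Real.log L with hℓdef
  have hγ0 : 1 / 2 < Real.eulerMascheroniConstant := Real.one_half_lt_eulerMascheroniConstant
  have hL : 0 < L := Real.log_pos (by exact_mod_cast hM)
  have hℓ0 : 0 < ℓ := by linarith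
  have h1 : 1 ∈ Finset.Icc 1 M := Finset.mem_Icc.2 ⟨le_rfl, by omega⟩
  have hν : L - Real.eulerMascheroniConstant / 2 < L + s := by linarith
  have hT : 0 < 1 / ℓ := by positivity
  have hT1 : 1 / ℓ ≤ 1 := by rw [div_le_one hℓ0]; linarith
  have hℓL : ℓ ≤ L := by
    have := Real.log_le_sub_one_of_pos hL; rw [← hℓdef] at this; linarith
  have hLT : 1 ≤ L * (1 / ℓ) := by
    rw [mul_one_div, le_div_iff₀ hℓ0, one_mul]; exact hℓL
  have hest := windowFloor_inv_le hM h1 hs hform hT hT1 hLT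
  rw [div_eq_mul_inv]
  have hkey : L * (windowFloor M (L + s))⁻¹ ≤
      L * ((Real.exp (71 * (1 / ℓ)) * (1 + Real.log (L * (1 / ℓ))) + Real.exp 71 * Real.log (1 / (1 / ℓ)) +
        4 * Real.exp 72) / L) := mul_le_mul_of_nonneg_left hest hL.le
  refine hkey.trans ?_
  have hlog : Real.log (L * (1 / ℓ)) = ℓ - Real.log ℓ := by
    rw [mul_one_div, Real.log_div hL.ne' hℓ0.ne']
  rw [hlog, one_div_one_div, mul_div_assoc', mul_comm L, mul_div_assoc, div_self hL.ne', mul_one]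
  -- e^{71/ℓ} ≤ 1 + 142/ℓ, (1 + ℓ − log ℓ) ≤ 1 + ℓ, 144 + 4e^{72} ≤ e^{75}
  have hx1 : 71 * (1 / ℓ) ≤ 1 := by
    rw [mul_one_div, div_le_one hℓ0]; linarith
  have hx0 : 0 ≤ 71 * (1 / ℓ) := by positivity
  have hexp : Real.exp (71 * (1 / ℓ)) ≤ 1 + 2 * (71 * (1 / ℓ)) := exp_le_one_add_two_mul hx0 hx1
  have hB0 : 0 ≤ 1 + (ℓ - Real.log ℓ) := by linarith [Real.log_le_sub_one_of_pos hℓ0]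
  have hB1 : 1 + (ℓ - Real.log ℓ) ≤ 1 + ℓ := by linarith [Real.log_nonneg (show (1 : ℝ) ≤ ℓ by linarith)]
  have hwin : Real.exp (71 * (1 / ℓ)) * (1 + (ℓ - Real.log ℓ)) ≤ ℓ + 144 := by
    have e142 : 2 * (71 * (1 / ℓ)) * ℓ = 142 := by field_simp; ring
    calc Real.exp (71 * (1 / ℓ)) * (1 + (ℓ - Real.log ℓ))
        ≤ (1 + 2 * (71 * (1 / ℓ))) * (1 + ℓ) := mul_le_mul hexp hB1 hB0 (by positivity)
      _ = 1 + ℓ + 2 * (71 * (1 / ℓ)) + 2 * (71 * (1 / ℓ)) * ℓ := by ring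
      _ ≤ ℓ + 144 := by rw [e142]; nlinarith
  have he72 : (144 : ℝ) ≤ 4 * Real.exp 72 := by linarith [Real.add_one_le_exp (72 : ℝ)]
  have he3 : (8 : ℝ) ≤ Real.exp 3 := by
    have h2 : (2 : ℝ) ≤ Real.exp 1 := by linarith [Real.add_one_le_exp (1 : ℝ)]
    have e : Real.exp 3 = Real.exp 1 * Real.exp 1 * Real.exp 1 := by
      rw [← Real.exp_add, ← Real.exp_add]; norm_num
    rw [e]; nlinarith [Real.exp_pos (1 : ℝ)]
  have he75 : 144 + 4 * Real.exp 72 ≤ Real.exp 75 := by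
    have e : Real.exp 75 = Real.exp 72 * Real.exp 3 := by rw [← Real.exp_add]; norm_num
    rw [e]; nlinarith [Real.exp_pos (72 : ℝ)]
  linarith

/-- **THEOREM N6₁, upper half**: for every `s ≥ 0`, for all large `M` (`L = log M`),
`L / f_M(L + s) ≤ log L + e^{71}·log log L + e^{75}`. -/
theorem log_div_windowFloor_le {s : ℝ} (hs : 0 ≤ s) :
    ∀ᶠ M : ℕ in atTop,
      Real.log M / windowFloor M (Real.log M + s) ≤
        Real.log (Real.log M) + Real.exp 71 * Real.log (Real.log (Real.log M)) + Real.exp 75 := by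
  filter_upwards [log_div_windowFloor_le_uniform] with M hM
  exact hM s hs

/-- ★ **THEOREM N6₁** (PIVOT-LAW 13.45; CONJECTURE N6 at its leading order, RH-free): for every fixed
`s ≥ 0` there is a constant `C` with `|log M / f_M(log M + s) − log log M| ≤ C·log log log M` for all large
`M`; in particular `f_M(log M + s) ~ log M / log log M`. -/
theorem n6_one {s : ℝ} (hs : 0 ≤ s) :
    ∃ C : ℝ, ∀ᶠ M : ℕ in atTop,
      |Real.log M / windowFloor M (Real.log M + s) - Real.log (Real.log M)| ≤
        C * Real.log (Real.log (Real.log M)) := by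
  refine ⟨Real.exp 71 + Real.exp 75 + s + 23, ?_⟩
  filter_upwards [log_div_windowFloor_ge hs, log_div_windowFloor_le hs,
    tendsto_log_log_log_natCast.eventually_ge_atTop (1 : ℝ)] with M hlo hup hlll
  set lll : ℝ := Real.log (Real.log (Real.log (M : ℝ))) with hlll_def
  have he0 : 0 ≤ (Real.exp 71 + Real.exp 75) * lll :=
    mul_nonneg (add_nonneg (Real.exp_pos _).le (Real.exp_pos _).le) (by linarith)
  have hs23 : s + 23 ≤ (s + 23) * lll := le_mul_of_one_le_right (by linarith) hlll
  have he75 : Real.exp 75 ≤ Real.exp 75 * lll := le_mul_of_one_le_right (Real.exp_pos _).le hlll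
  have he71 : 0 ≤ Real.exp 71 * lll := mul_nonneg (Real.exp_pos _).le (by linarith)
  have he1 : lll ≤ (Real.exp 71 + Real.exp 75) * lll :=
    le_mul_of_one_le_left (by linarith) (by linarith [Real.add_one_le_exp (71 : ℝ), Real.add_one_le_exp (75 : ℝ)])
  have hexpand : (Real.exp 71 + Real.exp 75 + s + 23) * lll =
      (Real.exp 71 + Real.exp 75) * lll + (s + 23) * lll := by ring
  have hexpand2 : (Real.exp 71 + Real.exp 75) * lll = Real.exp 71 * lll + Real.exp 75 * lll := by ring
  rw [abs_le, hexpand]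
  constructor
  · linarith
  · linarith

/-- **PROP. N5 (PIVOT-LAW 13.11) in the kernel: CONJECTURE N⁺ is false.**  There are no `s ≥ 0`, `φ > 0`
with `f_M(log M + s) ≥ φ·log M` for all large `M` (13.11 proved this by a Rankin bound through the
grand-canonical walk; here it is a corollary of THEOREM N6₁'s lower half). -/
theorem not_conjecture_Nplus :
    ¬ ∃ s : ℝ, 0 ≤ s ∧ ∃ φ : ℝ, 0 < φ ∧
      ∀ᶠ M : ℕ in atTop, φ * Real.log M ≤ windowFloor M (Real.log M + s) := by
  rintro ⟨s, hs, φ, hφ, hN⟩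
  -- log L − log log L − (s + 23) ≥ (log L)/2 − (s + 23) → ∞
  have hgrow : Tendsto (fun M : ℕ =>
      Real.log (Real.log (M : ℝ)) - Real.log (Real.log (Real.log (M : ℝ))) - (s + 23)) atTop atTop := by
    have h2 : Tendsto (fun M : ℕ => Real.log (Real.log (M : ℝ)) / 2 - (s + 23 + 1)) atTop atTop :=
      tendsto_atTop_add_const_right _ _ (tendsto_log_log_natCast.atTop_div_const (by norm_num))
    refine tendsto_atTop_mono' _ ?_ h2
    filter_upwards [tendsto_log_log_natCast.eventually_ge_atTop (2 : ℝ)] with M hℓ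
    have hℓ0 : 0 < Real.log (Real.log (M : ℝ)) := by linarith
    -- log ℓ ≤ log 2 + (ℓ/2 − 1) ≤ ℓ/2
    have hlog : Real.log (Real.log (Real.log (M : ℝ))) ≤ Real.log (Real.log (M : ℝ)) / 2 := by
      have h := Real.log_le_sub_one_of_pos (half_pos hℓ0)
      rw [Real.log_div hℓ0.ne' two_ne_zero] at h
      have h2 : Real.log 2 < 1 := by
        have := Real.log_two_lt_d9; linarith
      linarith
    linarith
  have hev := (hgrow.eventually_ge_atTop (1 / φ + 1))
  obtain ⟨M, hM1, hM2, hM3, hM4, hM5⟩ := (hN.and ((log_div_windowFloor_ge hs).and (hev.and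
    (windowFloor_pos_eventually.and (eventually_ge_atTop 2))))).exists
  have h1 : 1 ∈ Finset.Icc 1 M := Finset.mem_Icc.2 ⟨le_rfl, by omega⟩
  have hf : 0 < windowFloor M (Real.log M + s) := hM4 h1 s hs
  have hL : 0 < Real.log (M : ℝ) := Real.log_pos (by exact_mod_cast hM5)
  have hup : Real.log (M : ℝ) / windowFloor M (Real.log M + s) ≤ 1 / φ := by
    calc Real.log (M : ℝ) / windowFloor M (Real.log M + s) ≤ Real.log (M : ℝ) / (φ * Real.log M) :=
          div_le_div_of_nonneg_left hL.le (mul_pos hφ hL) hM1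
      _ = 1 / φ := by field_simp
  linarith

/-- THEOREM N6₁ in ratio form: `(log M / f_M(log M + s)) / log log M → 1`. -/
theorem tendsto_log_div_windowFloor_div {s : ℝ} (hs : 0 ≤ s) :
    Tendsto (fun M : ℕ => (Real.log M / windowFloor M (Real.log M + s)) / Real.log (Real.log M))
      atTop (nhds 1) := by
  obtain ⟨C, hC⟩ := n6_one hs
  -- |ratio − 1| ≤ C·log ℓ/ℓ → 0
  have hlim : Tendsto (fun M : ℕ => C * Real.log (Real.log (Real.log (M : ℝ))) / Real.log (Real.log (M : ℝ)))
      atTop (nhds 0) := by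
    have h1 : Tendsto (fun x : ℝ => Real.log x / x) atTop (nhds 0) := by
      have h := Real.tendsto_pow_log_div_mul_add_atTop 1 0 1 one_ne_zero
      simpa using h
    have h2 := h1.comp tendsto_log_log_natCast
    have h3 := h2.const_mul C
    rw [mul_zero] at h3
    refine h3.congr fun M => ?_
    simp only [Function.comp_apply]
    ring
  rw [tendsto_iff_norm_sub_tendsto_zero]
  refine squeeze_zero' (Filter.Eventually.of_forall fun M => norm_nonneg _) ?_ hlim
  filter_upwards [hC, tendsto_log_log_natCast.eventually_ge_atTop (1 : ℝ)] with M hM hℓ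
  have hℓ0 : 0 < Real.log (Real.log (M : ℝ)) := by linarith
  rw [Real.norm_eq_abs]
  have e : Real.log M / windowFloor M (Real.log M + s) / Real.log (Real.log M) - 1 =
      (Real.log M / windowFloor M (Real.log M + s) - Real.log (Real.log M)) / Real.log (Real.log M) := by
    field_simp
  rw [e, abs_div, abs_of_pos hℓ0, div_le_div_iff_of_pos_right hℓ0]
  exact hM

/-- THEOREM N6₁ for the floor itself: `f_M(log M + s)·log log M / log M → 1` (PIVOT-LAW 13.45: `f_M(log M + s) ~
log M/log log M`; PROP. N5′'s sharp constant, 13.12, met from the walk side). -/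
theorem tendsto_windowFloor_mul_log_log_div {s : ℝ} (hs : 0 ≤ s) :
    Tendsto (fun M : ℕ => windowFloor M (Real.log M + s) * Real.log (Real.log M) / Real.log M)
      atTop (nhds 1) := by
  have h := (tendsto_log_div_windowFloor_div hs).inv₀ one_ne_zero
  rw [inv_one] at h
  refine h.congr' ?_
  filter_upwards [eventually_ge_atTop 2, windowFloor_pos_eventually,
    tendsto_log_log_natCast.eventually_ge_atTop (1 : ℝ)] with M hM hpos hℓ
  have h1 : 1 ∈ Finset.Icc 1 M := Finset.mem_Icc.2 ⟨le_rfl, by omega⟩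
  have hf : 0 < windowFloor M (Real.log M + s) := hpos h1 s hs
  have hL : 0 < Real.log (M : ℝ) := Real.log_pos (by exact_mod_cast hM)
  have hℓ0 : 0 < Real.log (Real.log (M : ℝ)) := by linarith
  field_simp

end Asymptotic

end Summit.RiemannHypothesis.RiemannHypothesis.Theorems.IntegerScrew

end
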